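import Summits.ResolutionOfSingularities.ResolutionOfSingularities.Theorems.EquisingularLiftEquisingularLiftNatEmbeddedLiftOfFirstOrderAt
import HarnessLib

/-!
# [OURS · L1 W4.5(b) · EL♮(3) · (T-k) · R70 (ii) TWIN-1♭] THE (F)-ASSEMBLY MODULO GROTHENDIECK EXISTENCE FOR A PRINCIPAL IDEAL OF DEFINITION
# `EmbeddedInfinitesimalLiftFact → <E♭'s shape> → EmbeddedLiftFact`

res-L1-w45b-lead-2 g9 (TEXT OWNER of the crux chain w45b; pre-fit for the 45th registration «F-88 RETIREMENT», desk RULING R70 (ii)).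
OURS; NOT a statement of any manuscript ([Hironaka2017] is a candidate under adjudication, nothing of it is asserted); AI-written, weaker
than expert review.  No `sorry`; standard axioms; DEF-FREE; no named-fact hypothesis (the hypothesis `hGEp` is an INLINE ∀-statement of
E♭'s custody shape, byte-identical to the `hGEp` of ✓ `exists_flat_lift_of_firstOrder_of_principal`).  `--supports
stmt-ResolutionOfSingularities-20148`, counted 0.  EL♮(3) is NOT proved; F-88 is NOT paid by this file; resolution in char p is NOT proved.

WHAT.  ✓ `embeddedLiftFact_of_infinitesimal_of_grothendieckExistence` (res-type-027, …NatEmbeddedLiftOfInfinitesimal) derives (F) =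
`EmbeddedLiftFact` from J1 = `EmbeddedInfinitesimalLiftFact` and the NAMED FACT F-88 `GrothendieckExistence` (all ideals of definition).
Its ONE application of F-88 is at `(A, I, f) = (O, 𝔪_O, w)` with `O` a complete DVR, so `𝔪_O = (ϖ)` is PRINCIPAL.  This module re-derives
(F) from J1 and Grothendieck existence for PRINCIPAL ideals of definition only (`hGEp`, the shape in which res-type-027's THEOREM E♭
`grothendieckExistence_principal` is to land):
* `embeddedLiftFact_of_infinitesimal_of_grothendieckExistencePrincipal (hJ1) (hGEp) : EmbeddedLiftFact`;
* `embeddedCurveLiftFact_of_infinitesimal_of_grothendieckExistencePrincipal (hJ1) (hGEp) : EmbeddedCurveLiftFact` (∘ ✓ `embeddedCurveLiftFact_of_embeddedLiftFact`).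
So on E♭-day the registered skeleton's `stub_elnat_embeddedLiftFact` re-derives as
`embeddedLiftFact_of_infinitesimal_of_grothendieckExistencePrincipal stub_elnat_embeddedInfinitesimalLiftFact grothendieckExistence_principal`
and the NEED-FACT stub `stub_elnat_grothendieckExistence` loses its last consumer (TWIN-2 = ✓ `…NatEmbeddedLiftOfFirstOrderAt` +
res-L1-w45b-stub-4's `…NatNodalCurveLiftOfGEPrincipal`).

PROOF (single-call discipline, design note (xxxii)).  Level 0 → level 1 by ONE application of J1 to `Y₀ ↪ W₀ ≅ W ×_O O/𝔪` (the stage-0 datum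
of 027's recursion: `e 0 : W₀ ⟶ W_0` is an isomorphism because `O/𝔪 → k` is bijective; flatness over `O/𝔪` transported along it); then the
whole remaining tower + algebraisation + flatness + special fibre is res-L1-w45b-nose-w1's ✓ `exists_flat_lift_of_firstOrder_of_principal`
(…NatEmbeddedLiftOfFirstOrderAt, p700301) started at that first-order lift, whose middle conjunct (`C·𝒪_{W₁} = 𝓘_{Y₁}`) is dropped.
References (method / index only): R. Hartshorne, *Deformation Theory* (2010), Thm. 22.3 (proof); EGA III₁ 5.1.4 / Görtz–Wedhorn II Prop. 24.109.
-/

set_option linter.dupNamespace false -- mandated namespace `Summit.<Summit>.<Problem>` of this single-conjunct summit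

noncomputable section

open CategoryTheory CategoryTheory.Limits AlgebraicGeometry TopologicalSpace
open Literature.AlgebraicGeometry.Morphisms
open Literature.AlgebraicGeometry.Morphisms.infinitesimalNeighbourhood (toSpec transition transition_ι base)
open Literature.AlgebraicGeometry.Morphisms (CechMH1)
open Literature.AlgebraicGeometry.HodgeTheory (normalSheaf)
open AlgebraicGeometry.Scheme.IdealSheafData

namespace Summit.ResolutionOfSingularities.ResolutionOfSingularities.Cruxes.EquisingularLiftNat.Sections

/-- ★★ **TWIN-1♭: THE (F)-ASSEMBLY `J1 → (Grothendieck existence, principal ideal of definition) → (F)`** — ✓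
`embeddedLiftFact_of_infinitesimal_of_grothendieckExistence` with the named fact F-88 replaced by the inline principal-ideal form `hGEp`
(E♭'s custody shape).  One J1 step at level 0, then ✓ `exists_flat_lift_of_firstOrder_of_principal`.  See the module docstring.
[cite: Hartshorne2010, Thm. 22.3 (proof: stepwise lifting + Grothendieck existence)] [OURS · L1 W4.5b · R70 (ii) TWIN-1♭; counted 0] -/
theorem embeddedLiftFact_of_infinitesimal_of_grothendieckExistencePrincipal
    (hJ1 : EmbeddedInfinitesimalLiftFact)
    (hGEp : ∀ ⦃A : Type⦄ [CommRing A] [IsNoetherianRing A] (a : A) [IsAdicComplete (Ideal.span {a}) A] ⦃X : Scheme.{0}⦄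
      (f : X ⟶ Spec (.of A)) [IsProper f] (T : ℕ → Scheme.{0}) (j : ∀ n, T n ⟶ infinitesimalNeighbourhood (Ideal.span {a}) f n)
      (s : ∀ n, T n ⟶ T (n + 1)), (∀ n, IsClosedImmersion (j n)) → (∀ n, IsPullback (s n) (j n) (j (n + 1)) (transition (Ideal.span {a}) f n)) →
        ∃ (T' : Scheme.{0}) (i : T' ⟶ X), IsClosedImmersion i ∧ ∃ r : ∀ n, T n ⟶ T', ∀ n, IsPullback (r n) (j n) i (infinitesimalNeighbourhood.ι (Ideal.span {a}) f n)) :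
    EmbeddedLiftFact := by
  intro O _ _ _ _ k _ θ hθ W w W₀ jW tW hsq hprop hflat Y₀ ιY hι hlci hH1
  haveI := hprop; haveI := hflat; haveI := hι
  -- `θ` kills the maximal ideal (θ : O ↠ k onto a field, `O` local)
  have hIθ : (IsLocalRing.maximalIdeal O) ≤ RingHom.ker θ :=
    (IsLocalRing.eq_maximalIdeal (RingHom.ker_isMaximal_of_surjective θ hθ)).ge
  haveI : Fact (Function.Surjective θ) := ⟨hθ⟩
  -- the special fibre inside the infinitesimal neighbourhoods: `e n : W₀ ⟶ W_n`, closed immersions with `e n ≫ ι n = jW`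
  let e : ∀ n : ℕ, W₀ ⟶ infinitesimalNeighbourhood (IsLocalRing.maximalIdeal O) w n := fun n =>
    hsq.isoPullback.hom ≫ toInfinitesimalNeighbourhood (IsLocalRing.maximalIdeal O) w θ hIθ n
  have he_ι : ∀ n, e n ≫ infinitesimalNeighbourhood.ι (IsLocalRing.maximalIdeal O) w n = jW := by
    intro n; simp only [e, Category.assoc, toInfinitesimalNeighbourhood_ι, IsPullback.isoPullback_hom_fst]
  have he_tr : ∀ n, e n ≫ transition (IsLocalRing.maximalIdeal O) w n = e (n + 1) := by
    intro n; simp only [e, Category.assoc, toInfinitesimalNeighbourhood_transition]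
  haveI : ∀ n, IsClosedImmersion (e n) := fun n => by
    simp only [e]; infer_instance
  -- level 0: `Y₀ ↪ W_0` is flat over `O/𝔪` (`O/𝔪 → k` bijective) and restricts to `Y₀` along `jW`
  have h0flat : Flat ((ιY ≫ e 0) ≫ toSpec (IsLocalRing.maximalIdeal O) w 0) := by
    have heq : (ιY ≫ e 0) ≫ toSpec (IsLocalRing.maximalIdeal O) w 0 =
        (ιY ≫ tW) ≫ Spec.map (CommRingCat.ofHom (fibreRingHom (IsLocalRing.maximalIdeal O) θ hIθ 0)) := by
      simp only [e, Category.assoc, toInfinitesimalNeighbourhood_toSpec, IsPullback.isoPullback_hom_snd_assoc]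
    rw [heq]
    have hbij : Function.Bijective (fibreRingHom (IsLocalRing.maximalIdeal O) θ hIθ 0) := by
      refine ⟨RingHom.lift_injective_of_ker_le_ideal _ (fun a ha => hIθ (Ideal.pow_le_self (Nat.succ_ne_zero 0) ha)) ?_,
        fun b => ?_⟩
      · rw [pow_one]; exact (IsLocalRing.eq_maximalIdeal (RingHom.ker_isMaximal_of_surjective θ hθ)).le
      · obtain ⟨a, rfl⟩ := hθ b
        exact ⟨Ideal.Quotient.mk _ a, rfl⟩
    haveI : IsIso (CommRingCat.ofHom (fibreRingHom (IsLocalRing.maximalIdeal O) θ hIθ 0)) :=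
      (RingEquiv.ofBijective _ hbij).toCommRingCatIso.isIso_hom
    infer_instance
  have h0sq : IsPullback (𝟙 Y₀) ιY (ιY ≫ e 0) (e 0) := isPullback_id_of_mono ιY (e 0)
  have hres0 : ∃ s₀ : Y₀ ⟶ Y₀, IsPullback s₀ ιY ((ιY ≫ e 0) ≫ infinitesimalNeighbourhood.ι (IsLocalRing.maximalIdeal O) w 0) jW := by
    refine ⟨𝟙 Y₀, ?_⟩
    have h2 : IsPullback (𝟙 Y₀) (ιY ≫ e 0) ((ιY ≫ e 0) ≫ infinitesimalNeighbourhood.ι (IsLocalRing.maximalIdeal O) w 0)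
        (infinitesimalNeighbourhood.ι (IsLocalRing.maximalIdeal O) w 0) :=
      isPullback_id_of_mono (ιY ≫ e 0) (infinitesimalNeighbourhood.ι (IsLocalRing.maximalIdeal O) w 0)
    simpa [he_ι] using h0sq.paste_horiz h2
  -- ONE application of J1: the first-order lift `Y₁ ↪ W_1`
  obtain ⟨Y₁, j₁, s, hj₁, hj₁flat, hsq'⟩ := hJ1 O k θ hθ W w W₀ jW tW hsq hflat inferInstance Y₀ ιY hι hlci hH1 0 Y₀ (ιY ≫ e 0)
    inferInstance h0flat hres0
  haveI := hj₁
  -- its restriction to the special fibre: `Y₀ = Y₁ ×_W W₀`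
  have hres₁ : ∃ s₀ : Y₀ ⟶ Y₁, IsPullback s₀ ιY (j₁ ≫ infinitesimalNeighbourhood.ι (IsLocalRing.maximalIdeal O) w 1) jW := by
    refine ⟨𝟙 Y₀ ≫ s, ?_⟩
    have h1 : IsPullback (𝟙 Y₀ ≫ s) ιY j₁ (e 1) := by
      simpa [he_tr] using h0sq.paste_horiz hsq'
    have h2 : IsPullback (𝟙 Y₁) j₁ (j₁ ≫ infinitesimalNeighbourhood.ι (IsLocalRing.maximalIdeal O) w 1)
        (infinitesimalNeighbourhood.ι (IsLocalRing.maximalIdeal O) w 1) :=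
      isPullback_id_of_mono j₁ (infinitesimalNeighbourhood.ι (IsLocalRing.maximalIdeal O) w 1)
    simpa [he_ι] using h1.paste_horiz h2
  -- the rest of the tower, algebraisation (principal GE), flatness, special fibre: nose-w1's first-order assembly
  obtain ⟨C, hC, -, hC₀⟩ := exists_flat_lift_of_firstOrder_of_principal hGEp O k θ hθ W w W₀ jW tW hsq hprop hflat Y₀ ιY hι
    hlci hH1 Y₁ j₁ hj₁flat hres₁
  exact ⟨C, hC, hC₀⟩

/-- **The curve form**: `EmbeddedInfinitesimalLiftFact → <E♭'s shape> → EmbeddedCurveLiftFact` (∘ ✓ `embeddedCurveLiftFact_of_embeddedLiftFact`,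
…NatEmbeddedCurveLiftOfFactClosed).  [OURS · L1 W4.5b · R70 (ii) TWIN-1♭; counted 0] -/
theorem embeddedCurveLiftFact_of_infinitesimal_of_grothendieckExistencePrincipal
    (hJ1 : EmbeddedInfinitesimalLiftFact)
    (hGEp : ∀ ⦃A : Type⦄ [CommRing A] [IsNoetherianRing A] (a : A) [IsAdicComplete (Ideal.span {a}) A] ⦃X : Scheme.{0}⦄
      (f : X ⟶ Spec (.of A)) [IsProper f] (T : ℕ → Scheme.{0}) (j : ∀ n, T n ⟶ infinitesimalNeighbourhood (Ideal.span {a}) f n)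
      (s : ∀ n, T n ⟶ T (n + 1)), (∀ n, IsClosedImmersion (j n)) → (∀ n, IsPullback (s n) (j n) (j (n + 1)) (transition (Ideal.span {a}) f n)) →
        ∃ (T' : Scheme.{0}) (i : T' ⟶ X), IsClosedImmersion i ∧ ∃ r : ∀ n, T n ⟶ T', ∀ n, IsPullback (r n) (j n) i (infinitesimalNeighbourhood.ι (Ideal.span {a}) f n)) :
    EmbeddedCurveLiftFact :=
  embeddedCurveLiftFact_of_embeddedLiftFact (embeddedLiftFact_of_infinitesimal_of_grothendieckExistencePrincipal hJ1 hGEp)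

end Summit.ResolutionOfSingularities.ResolutionOfSingularities.Cruxes.EquisingularLiftNat.Sections

end
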